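import Summits.BirchSwinnertonDyer.Rank1Residual.Supersingular.BlindControlTwo
import Summits.BirchSwinnertonDyer.Rank1Residual.Supersingular.BlindPointFlatTwo
import HarnessLib

/-!
# (P₋₂) BOUND: the blind value law `L(−2) = u′ · 2^e · ([1/8]⁺ − [5/8]⁺)` holds with `e = 1` for the
# `♯`-function of EVERY Sprung pair and with `e = 2` for the `♭`-function at `a₂ = ±2`,
# `w(E ⊗ χ₈) = +1` — lens-1 G10 §4 `blindInterpolation_flat_of_sharp` PORTED with its binder `h9b`
# DISCHARGED by the tree theorem `BlindFlat.flatLaw_evalAt_neg_two` (cell `b2b-bsdres`, O1 sub-cell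
# `p = 2`; cc-typer-4 GEN 7, typer item (27⁗′) of o1 lead ruling R-G25.1 (e))

HONEST FRAMING (run/shared/lean/b2b/bsd-rank1-residual/, verbatim in every file): the goal of the
cell is to DELETE the COMBINATION-SHAPED residual classes of the Birch–Swinnerton-Dyer formula for
ALL analytic-rank `≤ 1` elliptic curves over `ℚ` — "full BSD formula for every rank `≤ 1` curve in
class `C`" assembled STRICTLY from published theorems — so that the rank-`≤ 1` remainder becomes
exactly the CONSTRUCTION-SHAPED classes, which are TYPED (missing-input `Prop`s), NOT attempted.
This is not "finishing BSD". THEOREMS ONLY about the tree's typed objects (`SignedDatum`,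
`IsSprungPair`, `mazurTateElement`, `ratPlusSymbol`, `BlindLever.evalAt`); every hypothesis
explicit; nothing about any particular curve, Selmer group or `L`-function is asserted; nothing
booked; no label moves.

WHAT. In the (α3) package (`BlindControlTwo.lean`, p290263) the VALUE LAW
`(P₋₂)` `SignedDatum.BlindInterpolation D S e : ∃ u ∈ ℤ₂ˣ, L(−2) = u · 2^e · S` is a hypothesis
predicate with `S ∈ ℚ` and `e ∈ ℕ` free; the o1 refuter (v14 §94, RIDER (α3)′) observed that with
`S` free it holds for every datum, so content enters only once `S := [1/8]⁺ − [5/8]⁺` and `e` are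
BOUND. This file binds them, as THEOREMS, for a datum whose `L` is a member of a Sprung pair of a
form `f` with rational coefficients, `2 ∤ N`, `a₂(f) = a` even:

* `♯` side (`blindInterpolation_sharp`): `L♯(−2) = (−1) · 2¹ · ([1/8]⁺_f − [5/8]⁺_f)` — packet B
  (p285534 `tsum_sharp_neg_two_eq_symbols`, there in `ℂ₂`) in the `ℤ₂`-valued `BlindLever.evalAt`
  language (`coe_evalAt_sharp_neg_two_eq`), for EVERY even `a`, no sign condition;
* `♭` side (`blindInterpolation_flat`): at `a = ±2` and `σ·χ₈(N) = +1`,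
  `L♭(−2) = (±5⁻¹) · 2² · ([1/8]⁺_f − [5/8]⁺_f)` — lens-1 G10 §4 `blindInterpolation_flat_of_sharp`
  (ported verbatim below, binders `hB`, `h9b`) with `hB` fed by the `♯` side and `h9b` fed by the
  blind `♭`-law `BlindFlat.flatLaw_evalAt_neg_two_cases` (p295520);
* REMARK R-L1-G11 (`two_dvd_evalAt_flat_neg_two`; lead C191 (d)): for every EVEN `a` and
  `σ·χ₈(N) = +1`, `2 ∣ L♭(−2)` in `ℤ₂` (`9 − a²` is a unit);
* for the newform of an elliptic curve (`…_of_isNewformOf`): good supersingular `2`, `a₂(E) = ±2`,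
  `w_E·χ₈(N_E) = +1`;
* the (α♭) door with (P₋₂) SHED (`bsdp_two_of_oneDivisibility_of_blindControl_flat`): p290263's
  assembly `bsdp_two_of_oneDivisibility_of_blindControl` with its input `hPb` discharged at `e = 2`,
  `S = [1/8]⁺ − [5/8]⁺` — the door's remaining ORDER-2-CHARACTER inputs are (K₋₂) at `e = 2` and the
  2-descent certificate (C₋₂), next to ONE signed divisibility and the trivial-character readings.
  Composition only; nothing asserted; no count, price or mark moves by it (o1 lead C183 (b)).

CREDIT. §1 is §4 of the o1 lens-1 GEN 10 packet `HOME/b2b-bsdres-o1-idea-1-g10/lean/G10_BlindControl.lean`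
(planner-b2b-bsdres-o1-idea-1-g10-0; source sha16 `f8aaf39f99956712`, l.321–358), ported VERBATIM up
to the namespace (`LensOneG10` ↦ `BlindLever`, as for §1–§3 in p290263); statement 9b = lens-1 GEN 9;
closed form `a₂/5` = o1 refuter v13 §83; the proof of 9b in the kernel = `BlindPointFlatTwo*.lean`.

References (shape only; nothing asserted): F. Sprung, ANT 11 (2017) Thm. 1.12, Cor. 4.4, §1.1
[Sprung2017]; B. Mazur, J. Tate, J. Teitelbaum, Invent. Math. 84 (1986) §I.17
[MazurTateTeitelbaum1986Invent]; A. Ray, F. Sprung, Ann. Inst. Fourier (2025) §1.2 [RaySprung2025];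
S. Kobayashi, Invent. Math. 152 (2003) Thm. 1.2 [Kobayashi2003]; R. L. Miller, LMS J. Comput. Math.
14 (2011) Def. 1.1 [Miller2011LMS]. Folder record: `HOME/class-closure/O1/TYPING.md` §10.
-/

set_option autoImplicit false

noncomputable section

open scoped Classical MatrixGroups ModularForm

open PowerSeries Polynomial CongruenceSubgroup Literature.NumberTheory.EllipticCurves
  Literature.NumberTheory.EllipticCurves.ModularForms Literature.NumberTheory.EllipticCurves.Sprung2017

namespace Summit.BirchSwinnertonDyer.Rank1Residual.Supersingular

namespace BlindLever

section Package

open WeierstrassCurve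

variable {W : WeierstrassCurve ℚ}

/-! ## §1. lens-1 G10 §4 verbatim: the `♭` value law at `a₂ = ±2` is FORCED by 9b + packet B
(index `e = 2`, unit `±1/5`) -/

/-- `5` is a unit of `ℤ₂`. [folklore] -/
theorem isUnit_five : IsUnit (5 : ℤ_[2]) := by
  rw [PadicInt.isUnit_iff]
  have hle : ‖(5 : ℤ_[2])‖ ≤ 1 := PadicInt.norm_le_one _
  have hlt : ¬ ‖(5 : ℤ_[2])‖ < 1 := by
    rw [show (5 : ℤ_[2]) = ((5 : ℤ) : ℤ_[2]) by norm_cast, PadicInt.norm_int_lt_one_iff_dvd]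
    decide
  exact le_antisymm hle (not_lt.mp hlt)

/-- **(P₋₂)♭ DERIVED (lens-1 G10 §4).** If the ♯-value is `L♯(−2) = −2S` (binder `hB` in `ℚ₂`;
packet B) and the 9b law `5·L♭(−2) = −a₂·L♯(−2)` holds (binder `h9b`), then at `a₂ = ±2` the
♭-datum satisfies the blind value law with index `e = 2` EXACTLY: `L♭(−2) = (±1/5) · 2² · S`.
Nothing asserted. [cite: Sprung2017, Cor. 4.4 and §1.1 (shape only; nothing asserted)] -/
theorem blindInterpolation_flat_of_sharp (D : SignedDatum W 2) (Ls : IwasawaAlgebra 2) (S : ℚ)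
    {a₂ : ℤ} (ha : a₂ = 2 ∨ a₂ = -2)
    (hB : ((evalAt (-2 : ℤ_[2]) Ls : ℤ_[2]) : ℚ_[2]) = -2 * ((S : ℚ) : ℚ_[2]))
    (h9b : (5 : ℚ_[2]) * ((evalAt (-2 : ℤ_[2]) D.L : ℤ_[2]) : ℚ_[2]) =
      -(a₂ : ℚ_[2]) * ((evalAt (-2 : ℤ_[2]) Ls : ℤ_[2]) : ℚ_[2])) :
    D.BlindInterpolation S 2 := by
  obtain ⟨v, hv⟩ := isUnit_five
  -- `x := v⁻¹ ∈ ℤ₂^×` seen in `ℚ₂` satisfies `5x = 1`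
  have hx : (5 : ℚ_[2]) * (((v⁻¹ : ℤ_[2]ˣ) : ℤ_[2]) : ℚ_[2]) = 1 := by
    rw [show (5 : ℚ_[2]) = ((5 : ℤ_[2]) : ℚ_[2]) by norm_cast, ← hv, ← PadicInt.coe_mul,
      Units.mul_inv, PadicInt.coe_one]
  rcases ha with rfl | rfl
  · -- `a₂ = 2`: `L♭(−2) = (1/5) · 2² · S`
    refine ⟨v⁻¹, ?_⟩
    push_cast at h9b
    linear_combination (-((evalAt (-2 : ℤ_[2]) D.L : ℤ_[2]) : ℚ_[2])) * hx +
      (((v⁻¹ : ℤ_[2]ˣ) : ℤ_[2]) : ℚ_[2]) * h9b + (-2 * (((v⁻¹ : ℤ_[2]ˣ) : ℤ_[2]) : ℚ_[2])) * hB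
  · -- `a₂ = −2`: `L♭(−2) = (−1/5) · 2² · S`
    refine ⟨-v⁻¹, ?_⟩
    push_cast at h9b
    rw [Units.val_neg, PadicInt.coe_neg]
    linear_combination (-((evalAt (-2 : ℤ_[2]) D.L : ℤ_[2]) : ℚ_[2])) * hx +
      (((v⁻¹ : ℤ_[2]ˣ) : ℤ_[2]) : ℚ_[2]) * h9b + (2 * (((v⁻¹ : ℤ_[2]ˣ) : ℤ_[2]) : ℚ_[2])) * hB

/-! ## §2. The binders fed: `hB` by packet B in `ℤ₂`-valued form, `h9b` by the blind `♭`-law -/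

section Form

variable {N : ℕ} [NeZero N] {f : CuspForm (Gamma0 N) 2}

/-- **`L♯(−2) = −2 · ([1/8]⁺ − [5/8]⁺)` in `ℚ₂`** for the `♯`-function of EVERY Sprung pair of a
form `f` with rational coefficients, `2 ∤ N`, `a₂(f) = a` even (the value `BlindLever.evalAt (−2) L♯ ∈ ℤ₂`
read in `ℚ₂`): level `n = 1` of the Sprung identity `Θ₁ + u₁L♯ + v₁L♭ = ω₁R₁` valued at `−2`
(`BlindFlat.evalAt_and_derivAt_of_isSprungPair`: `Θ₁(−2) = −c₁·L♯(−2)`, `c₁ = 1`) and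
`θ₁(−2) = 2([1/8]⁺ − [5/8]⁺)` (packet B `eval_neg_two_mazurTateElement_one`). This is packet B's
`tsum_sharp_neg_two_eq_symbols` (there a `ℂ₂`-valued sum) in the `evalAt` language.
[cite: Sprung2017, Cor. 4.4] [cite: MazurTateTeitelbaum1986Invent, §I.17] -/
theorem coe_evalAt_sharp_neg_two_eq (hf0 : IsNewform0 f) (hQ : coeffField f = ⊥) (hN2 : ¬ 2 ∣ N)
    {a : ℤ} (hap : cuspCoeff f 2 = a) (ha : (2 : ℤ) ∣ a) {Ls Lf : IwasawaAlgebra 2}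
    (hSP : IsSprungPair f 2 a Ls Lf) :
    ((evalAt (-2 : ℤ_[2]) Ls : ℤ_[2]) : ℚ_[2]) =
      -2 * ((ratPlusSymbol f ((1 : ℚ) / 8) - ratPlusSymbol f ((5 : ℚ) / 8) : ℚ) : ℚ_[2]) := by
  obtain ⟨Θ, hΘ⟩ := Sprung2017.exists_map_eq_map_mazurTateElement_two hf0 hQ hN2 hap ha 1
  have hV := (BlindFlat.evalAt_and_derivAt_of_isSprungPair hSP le_rfl hΘ).1
  rw [BlindFlat.cSeq_one, Int.cast_one] at hV
  have hΘv := BlindFlat.coe_evalAt_eq_of_map_eq hΘ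
  rw [eval_neg_two_mazurTateElement_one] at hΘv
  have hLs : evalAt (-2 : ℤ_[2]) Ls = -evalAt (-2 : ℤ_[2]) (Θ : PowerSeries ℤ_[2]) := by
    linear_combination hV
  rw [hLs, PadicInt.coe_neg, hΘv]
  push_cast
  ring

/-- **(P₋₂)♯ BOUND: `e = 1`, `u′ = −1`, `S = [1/8]⁺_f − [5/8]⁺_f`** for a datum whose `L` is the
`♯`-function of a Sprung pair of `f` (rational coefficients, `2 ∤ N`, `a₂(f) = a` even; no sign
condition). [cite: Sprung2017, Cor. 4.4 and §1.1] -/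
theorem blindInterpolation_sharp (D : SignedDatum W 2) (hf0 : IsNewform0 f) (hQ : coeffField f = ⊥)
    (hN2 : ¬ 2 ∣ N) {a : ℤ} (hap : cuspCoeff f 2 = a) (ha : (2 : ℤ) ∣ a) {Lf : IwasawaAlgebra 2}
    (hSP : IsSprungPair f 2 a D.L Lf) :
    D.BlindInterpolation (ratPlusSymbol f ((1 : ℚ) / 8) - ratPlusSymbol f ((5 : ℚ) / 8)) 1 := by
  refine ⟨-1, ?_⟩
  rw [coe_evalAt_sharp_neg_two_eq hf0 hQ hN2 hap ha hSP, Units.val_neg, Units.val_one,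
    PadicInt.coe_neg, PadicInt.coe_one]
  ring

/-- **(P₋₂)♭ BOUND: `e = 2`, `u′ = ±5⁻¹`, `S = [1/8]⁺_f − [5/8]⁺_f`** for a datum whose `L` is the
`♭`-function of a Sprung pair `(L♯, L) = (Ls, D.L)` of `f` (rational coefficients, `2 ∤ N`,
`a₂(f) = a ∈ {2, −2}`, Fricke sign `σ` with `σ·χ₈(N) = +1`): lens-1 G10 §4 with BOTH binders fed —
`hB` by `coe_evalAt_sharp_neg_two_eq`, `h9b` by `BlindFlat.flatLaw_evalAt_neg_two_cases`.
[cite: Sprung2017, Thm. 1.12, Cor. 4.4 and §1.1] [cite: MazurTateTeitelbaum1986Invent, §I.17] -/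
theorem blindInterpolation_flat (D : SignedDatum W 2) (hf0 : IsNewform0 f) (hQ : coeffField f = ⊥)
    (hN2 : ¬ 2 ∣ N) {a : ℤ} (hap : cuspCoeff f 2 = a) (ha : a = 2 ∨ a = -2) {σ : ℤ}
    (hσ : σ = 1 ∨ σ = -1) (hW : IsFrickeEigen N f (-(σ : ℂ)))
    (hsign : σ * ZMod.χ₈ (N : ZMod 8) = 1) {Ls : IwasawaAlgebra 2}
    (hSP : IsSprungPair f 2 a Ls D.L) :
    D.BlindInterpolation (ratPlusSymbol f ((1 : ℚ) / 8) - ratPlusSymbol f ((5 : ℚ) / 8)) 2 := by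
  have ha2 : (2 : ℤ) ∣ a := by rcases ha with rfl | rfl <;> norm_num
  have hB := coe_evalAt_sharp_neg_two_eq hf0 hQ hN2 hap ha2 hSP
  have h9 := (BlindFlat.flatLaw_evalAt_neg_two_cases hf0 hQ hN2 hap hσ hW hsign hSP).1 ha
  have h9' := congrArg (fun z : ℤ_[2] ↦ (z : ℚ_[2])) h9
  have h5c : ((5 : ℤ_[2]) : ℚ_[2]) = 5 := by norm_cast
  push_cast [h5c] at h9'
  refine blindInterpolation_flat_of_sharp D Ls _ ha hB ?_
  linear_combination h9'

/-- **REMARK R-L1-G11 (o1 lead C189 (d) / C191 (d)): `L♭(−2) ≡ 0 (mod 2)`** for the `♭`-function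
of every Sprung pair of a form with rational coefficients, `2 ∤ N`, `a₂(f) = a` EVEN and a Fricke
sign `σ` with `σ·χ₈(N) = +1`: the blind `♭`-law `(9 − a²)·L♭(−2) = −a·L♯(−2)`
(`BlindFlat.flatLaw_evalAt_neg_two`) with `9 − a²` odd, hence a unit of `ℤ₂`, and `2 ∣ a`.
[cite: Sprung2017, Thm. 1.12 and Cor. 4.4] [cite: MazurTateTeitelbaum1986Invent, §I.17] -/
theorem two_dvd_evalAt_flat_neg_two (hf0 : IsNewform0 f) (hQ : coeffField f = ⊥) (hN2 : ¬ 2 ∣ N)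
    {a : ℤ} (hap : cuspCoeff f 2 = a) (ha : (2 : ℤ) ∣ a) {σ : ℤ} (hσ : σ = 1 ∨ σ = -1)
    (hW : IsFrickeEigen N f (-(σ : ℂ))) (hsign : σ * ZMod.χ₈ (N : ZMod 8) = 1)
    {Ls Lf : IwasawaAlgebra 2} (hSP : IsSprungPair f 2 a Ls Lf) :
    (2 : ℤ_[2]) ∣ evalAt (-2 : ℤ_[2]) Lf := by
  have h := BlindFlat.flatLaw_evalAt_neg_two hf0 hQ hN2 hap ha hσ hW hsign hSP
  obtain ⟨k, rfl⟩ := ha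
  -- `9 − a²` is an odd integer, hence a unit of `ℤ₂`
  have hodd : ¬ (2 : ℤ) ∣ 9 - (2 * k) ^ 2 := by
    rw [show (9 : ℤ) - (2 * k) ^ 2 = 2 * (4 - 2 * k ^ 2) + 1 by ring,
      dvd_add_right (dvd_mul_right 2 _)]
    norm_num
  have hu : IsUnit ((9 : ℤ_[2]) - (((2 * k : ℤ)) : ℤ_[2]) ^ 2) := by
    rw [show (9 : ℤ_[2]) - (((2 * k : ℤ)) : ℤ_[2]) ^ 2 = (((9 - (2 * k) ^ 2 : ℤ)) : ℤ_[2]) by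
      push_cast; ring, PadicInt.isUnit_iff]
    exact le_antisymm (PadicInt.norm_le_one _)
      (not_lt.mp (mt (PadicInt.norm_int_lt_one_iff_dvd _).mp hodd))
  obtain ⟨u, hu'⟩ := hu
  refine ⟨-(((u⁻¹ : ℤ_[2]ˣ) : ℤ_[2]) * (k : ℤ_[2]) * evalAt (-2 : ℤ_[2]) Ls), ?_⟩
  calc evalAt (-2 : ℤ_[2]) Lf
      = ((u⁻¹ : ℤ_[2]ˣ) : ℤ_[2]) * ((u : ℤ_[2]) * evalAt (-2 : ℤ_[2]) Lf) := by
        rw [← mul_assoc, Units.inv_mul, one_mul]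
    _ = ((u⁻¹ : ℤ_[2]ˣ) : ℤ_[2]) * (-(((2 * k : ℤ)) : ℤ_[2]) * evalAt (-2 : ℤ_[2]) Ls) := by
        rw [hu']; congr 1; linear_combination h
    _ = 2 * -(((u⁻¹ : ℤ_[2]ˣ) : ℤ_[2]) * (k : ℤ_[2]) * evalAt (-2 : ℤ_[2]) Ls) := by
        push_cast; ring

end Form

/-! ## §3. For the newform of an elliptic curve -/

section Curve

variable [W.IsElliptic] [W.IsGloballyMinimal] [NeZero (W.conductorNorm ℤ)]
  {f : CuspForm (Gamma0 (W.conductorNorm ℤ)) 2}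

/-- **(P₋₂)♯ for a curve**: `E = W/ℚ` with good supersingular reduction at `2` (`2 ∣ a₂(E)`),
`f` its newform, `D` a signed datum at `(E, 2)` whose `L` is the `♯`-function of a Sprung pair of
`E`: `L(−2) = (−1) · 2 · ([1/8]⁺_f − [5/8]⁺_f)`. [cite: Sprung2017, Cor. 4.4 and §1.1] -/
theorem blindInterpolation_sharp_of_isNewformOf (D : SignedDatum W 2) (hf : IsNewformOf W f)
    (hgood : W.HasGoodReductionAtPrime 2) (hss : (2 : ℤ) ∣ W.frobeniusTrace 2)
    {Lf : IwasawaAlgebra 2} (hSP : IsSprungPair f 2 (W.frobeniusTrace 2) D.L Lf) :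
    D.BlindInterpolation (ratPlusSymbol f ((1 : ℚ) / 8) - ratPlusSymbol f ((5 : ℚ) / 8)) 1 :=
  blindInterpolation_sharp D hf.1 hf.coeffField_eq_bot (not_dvd_level_of_isNewformOf hf hgood)
    (cuspCoeff_eq_frobeniusTrace_of_isNewformOf_holds hf hgood) hss hSP

/-- **(P₋₂)♭ for a curve**: `E = W/ℚ` with good supersingular reduction at `2` and `a₂(E) = ±2`,
`f` its newform, `w_E · χ₈(N_E) = +1`, `D` a signed datum at `(E, 2)` whose `L` is the `♭`-function
of a Sprung pair `(Ls, D.L)` of `E`: `L(−2) = (±5⁻¹) · 2² · ([1/8]⁺_f − [5/8]⁺_f)` — the blind value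
law with index `e = 2`. [cite: Sprung2017, Thm. 1.12, Cor. 4.4 and §1.1]
[cite: MazurTateTeitelbaum1986Invent, §I.17] -/
theorem blindInterpolation_flat_of_isNewformOf (D : SignedDatum W 2) (hf : IsNewformOf W f)
    (hgood : W.HasGoodReductionAtPrime 2)
    (ha : W.frobeniusTrace 2 = 2 ∨ W.frobeniusTrace 2 = -2)
    (hsign : W.rootNumber * ZMod.χ₈ (W.conductorNorm ℤ : ZMod 8) = 1) {Ls : IwasawaAlgebra 2}
    (hSP : IsSprungPair f 2 (W.frobeniusTrace 2) Ls D.L) :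
    D.BlindInterpolation (ratPlusSymbol f ((1 : ℚ) / 8) - ratPlusSymbol f ((5 : ℚ) / 8)) 2 :=
  blindInterpolation_flat D hf.1 hf.coeffField_eq_bot (not_dvd_level_of_isNewformOf hf hgood)
    (cuspCoeff_eq_frobeniusTrace_of_isNewformOf_holds hf hgood) ha W.rootNumber_eq_one_or
    (isFrickeEigen_neg_rootNumber hf) hsign hSP

/-! ## §4. The (α♭) door with (P₋₂) shed -/

open Literature.NumberTheory.EllipticCurves.Rank1Residual
  Literature.NumberTheory.EllipticCurves.Rank1Residual.Typed

/-- **R-L1-G10-B ASSEMBLY with (P₋₂)♭ DISCHARGED (`p = 2`, analytic rank `0`, `a₂ = ±2`).**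
p290263's `bsdp_two_of_oneDivisibility_of_blindControl` for a datum `D = (ξ, L♭, c)` whose `L` is
the `♭`-function of a Sprung pair of the newform `f` of `E` (`a₂(E) = ±2`, `w_E·χ₈(N_E) = +1`), with
the value law (P₋₂) no longer an input: it holds at `e = 2`, `S = [1/8]⁺_f − [5/8]⁺_f` by
`blindInterpolation_flat_of_isNewformOf`. Remaining inputs: the trivial-character readings (K), (P),
`2 ∤ c`, `E[2]` irreducible, GZK, `L(E,1) ≠ 0`, ONE signed divisibility, and at the order-2
character (K₋₂) at index `2` for a `ℚ`-model `Wd` of `E^{(2)}` plus the 2-descent certificate (C₋₂)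
at `S = [1/8]⁺_f − [5/8]⁺_f`. Composition only; nothing asserted.
[cite: RaySprung2025, §1.2 (p. 2343)] [cite: Kobayashi2003, §3 and Thm. 1.2]
[cite: Miller2011LMS, Def. 1.1] [cite: Sprung2017, Thm. 1.12 and Cor. 4.4] -/
theorem bsdp_two_of_oneDivisibility_of_blindControl_flat
    (hGZK : rank_eq_analyticRank_of_analyticRank_le_one)
    (hirr : W.HasIrreducibleModPGaloisRep 2) (hL : W.entireLFunction 1 ≠ 0) (D : SignedDatum W 2)
    (hc : ¬ 2 ∣ D.c) (hK : D.EulerCharacteristic) (hP : D.Interpolation)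
    (hdiv : D.LowerDivisibility ∨ D.UpperDivisibility)
    (hf : IsNewformOf W f) (hgood : W.HasGoodReductionAtPrime 2)
    (ha : W.frobeniusTrace 2 = 2 ∨ W.frobeniusTrace 2 = -2)
    (hsign : W.rootNumber * ZMod.χ₈ (W.conductorNorm ℤ : ZMod 8) = 1) {Ls : IwasawaAlgebra 2}
    (hSP : IsSprungPair f 2 (W.frobeniusTrace 2) Ls D.L)
    {Wd : WeierstrassCurve ℚ} (htw : ∃ C : VariableChange ℚ, C • W.quadraticTwist 2 = Wd)
    (hKb : D.BlindEulerCharacteristicAt Wd 2)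
    (hCb : BlindDescentCertificate Wd
      (ratPlusSymbol f ((1 : ℚ) / 8) - ratPlusSymbol f ((5 : ℚ) / 8))) : BSDp W 2 :=
  bsdp_two_of_oneDivisibility_of_blindControl W hGZK hirr hL D hc hK hP hdiv htw hKb
    (blindInterpolation_flat_of_isNewformOf D hf hgood ha hsign hSP) hCb

end Curve

end Package

end BlindLever

end Summit.BirchSwinnertonDyer.Rank1Residual.Supersingular

end
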